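import Literature.Probability.LatticeModels.TwoCurrentClusterCalculus
import HarnessLib

/-!
# Crux `CoulombImpliesNontrivial` (stmt-CriticalPhenomena-13885, route PerfectScreening r3), line
# `merging-is-expected-screening`: registered stub `stub_thinFatLaw` (the exact THIN/FAT two-cluster law)

For edge couplings `K ≥ 0` on a finite simple graph `G`, disjoint vertex sets `A, A'`, roots `a, c`, and
source sets `S ⊆ A` (first current), `T ⊆ A'` (second current):

`M(A,A') · Z_A[∅]² · Z_{A'}[∅]² = J_A(a; S,∅) · J_{A'}(c; ∅,T) · Z_{A∪A'}[∅]²`,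

where `M(A,A') = Σ_p w(p₁)w(p₂) 1{∂p₁=S} 1{∂p₂=T} 1{C_{p₁+p₂}(a)=A} 1{C_{p₁+p₂}(c)=A'}`,
`Z_X[∅] = ecurrentSum (cutCoupling K X) ∅` (sourceless currents of `G ∖ X`) and `J = Current.jmass` (the
frozen-cluster two-current mass of `TwoCurrentClusterCalculus`).  In probabilistic terms,
`P^{S,T}[C(a)=A, C(c)=A'] = P^{S,∅}[C(a)=A] · P^{∅,T}[C(c)=A'] · Φ(A,A')²`, `Φ = Z Z_{A∪A'}/(Z_A Z_{A'})`.

Proof.  One splice identity with a spectator weight (`splice_phi`, the common generalisation of the tree's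
`Current.jmass_splice` and `Current.pair_splice`: the involution exchanging the parts off `A` of `(p₁,p₂)`
with an outer sourceless pair supported off `A` preserves the weights, the cluster of the root and every
weight `Φ` blind to the part of the current meeting `A`), used twice:
(1) at `A` with `Φ = 1{C(c) = A'}` (`c ∉ A`; `Current.cluster_spliceOff_eq_of_notMem`):
    `M · Z_A[∅]² = J_A(a;S,∅) · J'`, `J'` the frozen-cluster mass of `c` for the couplings cut off at `A`;
(2) at `A'` with `Φ = 1{supported off A}` (an edge meeting both `A` and `A' = C(c)` carries no current):
    `J' · Z_{A'}[∅]² = J_{A'}(c;∅,T) · Z_{A∪A'}[∅]²` (`cutCoupling_cutCoupling`).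
Everything is proved; nothing is defined or cited as a fact. [AizenmanCMP1982, §5; Aizenman1982, Lemma 9.3]
-/

noncomputable section

namespace Summit.CriticalPhenomena.Ising3DConformalLimit.Cruxes.CoulombImpliesNontrivial.MergingIsExpectedScreening

open Finset
open Literature.Probability.LatticeModels
open scoped symmDiff ENNReal

section Splice

variable {V : Type*} [Fintype V] [DecidableEq V] {G : SimpleGraph V} [DecidableRel G.Adj]

/-- **The two-slot splice identity with a spectator weight** (common generalisation of the tree's
`Current.jmass_splice` and `Current.pair_splice`).  For `K ≥ 0`, a vertex set `A`, source sets `S, T` and a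
weight `Φ ≥ 0` on currents which does not see the part of the current meeting `A`
(`Φ (spliceOff A k m) = Φ m` whenever `C_m(u) = A` and `k` is supported off `A`):
`(Σ_{∂p₁=S, ∂p₂=T} w w 1{C_{p₁+p₂}(u)=A} Φ(p₁+p₂)) · Z_A[∅]²
   = J_A(S ∩ A, T ∩ A) · (Σ_{∂q₁=S∖A, ∂q₂=T∖A} w_A w_A Φ(q₁+q₂))`.
[cite: AizenmanCMP1982, §5 (conditioning on clusters)] -/
theorem splice_phi {K : G.edgeFinset → ℝ} (hK : ∀ e, 0 ≤ K e) (u : V) (A S T : Finset V)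
    (Φ : Current G → ℝ≥0∞)
    (hΦ : ∀ m k : Current G, m.cluster u = A → Current.IsSupp (offGraph G A) k →
      Φ (Current.spliceOff A k m) = Φ m) :
    (∑' p : Current G × Current G,
        epairWeight K S T p * (if (p.1 + p.2).cluster u = A then 1 else 0) * Φ (p.1 + p.2)) *
      (∑' q : Current G × Current G, epairWeight (cutCoupling K A) ∅ ∅ q) =
    (∑' p : Current G × Current G,
        epairWeight K (S.filter (· ∈ A)) (T.filter (· ∈ A)) p * (if (p.1 + p.2).cluster u = A then 1 else 0)) *
      (∑' q : Current G × Current G,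
        epairWeight (cutCoupling K A) (S.filter (· ∉ A)) (T.filter (· ∉ A)) q * Φ (q.1 + q.2)) := by
  -- adapted from `Current.jmass_splice` (TwoCurrentClusterCalculus) and `Current.pair_splice` (UrsellMonotonicityTwo)
  set PA : (Current G × Current G) × (Current G × Current G) → Prop := fun x =>
    (x.1.1.sources = S ∧ x.1.2.sources = T) ∧ (x.1.1 + x.1.2).cluster u = A ∧
      ((Current.IsSupp (offGraph G A) x.2.1 ∧ x.2.1.sources = ∅) ∧
        (Current.IsSupp (offGraph G A) x.2.2 ∧ x.2.2.sources = ∅)) with hPA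
  set PB : (Current G × Current G) × (Current G × Current G) → Prop := fun x =>
    (x.1.1.sources = S.filter (· ∈ A) ∧ x.1.2.sources = T.filter (· ∈ A)) ∧ (x.1.1 + x.1.2).cluster u = A ∧
      ((Current.IsSupp (offGraph G A) x.2.1 ∧ x.2.1.sources = S.filter (· ∉ A)) ∧
        (Current.IsSupp (offGraph G A) x.2.2 ∧ x.2.2.sources = T.filter (· ∉ A))) with hPB
  set wA : (Current G × Current G) × (Current G × Current G) → ℝ≥0∞ := fun x =>
    x.1.1.eweight K * x.1.2.eweight K * Φ (x.1.1 + x.1.2) * (x.2.1.eweight K * x.2.2.eweight K) with hwA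
  set wB : (Current G × Current G) × (Current G × Current G) → ℝ≥0∞ := fun x =>
    x.1.1.eweight K * x.1.2.eweight K * (x.2.1.eweight K * x.2.2.eweight K * Φ (x.2.1 + x.2.2)) with hwB
  have hL : (∑' p : Current G × Current G,
        epairWeight K S T p * (if (p.1 + p.2).cluster u = A then 1 else 0) * Φ (p.1 + p.2)) *
      (∑' q : Current G × Current G, epairWeight (cutCoupling K A) ∅ ∅ q) =
      ∑' x, (if PA x then wA x else 0) := by
    rw [tsum_mul_tsum_eq_tsum_prod]
    refine tsum_congr fun x => ?_
    rw [Current.epairWeight_cutCoupling, epairWeight]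
    by_cases h1 : x.1.1.sources = S ∧ x.1.2.sources = T <;>
      by_cases h2 : (x.1.1 + x.1.2).cluster u = A <;>
      by_cases h3 : (Current.IsSupp (offGraph G A) x.2.1 ∧ x.2.1.sources = ∅) ∧
        (Current.IsSupp (offGraph G A) x.2.2 ∧ x.2.2.sources = ∅) <;>
      simp [hPA, hwA, h1, h2, h3, mul_assoc]
  have hR : (∑' p : Current G × Current G,
        epairWeight K (S.filter (· ∈ A)) (T.filter (· ∈ A)) p * (if (p.1 + p.2).cluster u = A then 1 else 0)) *
      (∑' q : Current G × Current G,
        epairWeight (cutCoupling K A) (S.filter (· ∉ A)) (T.filter (· ∉ A)) q * Φ (q.1 + q.2)) =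
      ∑' x, (if PB x then wB x else 0) := by
    rw [tsum_mul_tsum_eq_tsum_prod]
    refine tsum_congr fun x => ?_
    rw [Current.epairWeight_cutCoupling, epairWeight]
    by_cases h1 : x.1.1.sources = S.filter (· ∈ A) ∧ x.1.2.sources = T.filter (· ∈ A) <;>
      by_cases h2 : (x.1.1 + x.1.2).cluster u = A <;>
      by_cases h3 : (Current.IsSupp (offGraph G A) x.2.1 ∧ x.2.1.sources = S.filter (· ∉ A)) ∧
        (Current.IsSupp (offGraph G A) x.2.2 ∧ x.2.2.sources = T.filter (· ∉ A)) <;>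
      simp [hPB, hwB, h1, h2, h3, mul_assoc]
  rw [hL, hR]
  -- the involution
  set f : (Current G × Current G) × (Current G × Current G) →
      (Current G × Current G) × (Current G × Current G) := fun x =>
    ((Current.spliceOff A x.1.1 x.2.1, Current.spliceOff A x.1.2 x.2.2),
      (Current.spliceOff A x.2.1 x.1.1, Current.spliceOff A x.2.2 x.1.2)) with hf
  have hinv : Function.Involutive f := by
    rintro ⟨⟨p₁, p₂⟩, ⟨q₁, q₂⟩⟩
    simp only [hf, Current.spliceOff_spliceOff]
  have hself : ∀ X : Finset V, (X.filter (· ∈ A)).filter (· ∈ A) = X.filter (· ∈ A) := fun X => by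
    rw [Finset.filter_filter]; exact Finset.filter_congr fun x _ => and_self_iff
  have hself' : ∀ X : Finset V, (X.filter (· ∉ A)).filter (· ∉ A) = X.filter (· ∉ A) := fun X => by
    rw [Finset.filter_filter]; exact Finset.filter_congr fun x _ => and_self_iff
  have hnone : ∀ X : Finset V, (X.filter (· ∈ A)).filter (· ∉ A) = ∅ := fun X => by
    rw [Finset.filter_filter]; exact Finset.filter_false_of_mem fun x _ h => h.2 h.1
  -- transfer of the constraints along `f`
  have htrans : ∀ x, PA x → PB (f x) ∧ wA x = wB (f x) := by
    rintro ⟨⟨p₁, p₂⟩, ⟨q₁, q₂⟩⟩ ⟨⟨hp₁, hp₂⟩, hC, ⟨hq₁, hq₁s⟩, ⟨hq₂, hq₂s⟩⟩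
    have hC' : (p₂ + p₁).cluster u = A := by rwa [add_comm]
    obtain ⟨-, hsupp₁, hsrc₁, hsrc₁'⟩ := Current.splice_transfer hC' hq₁
    obtain ⟨-, hsupp₂, hsrc₂, hsrc₂'⟩ := Current.splice_transfer hC hq₂
    have hCf : (Current.spliceOff A p₁ q₁ + Current.spliceOff A p₂ q₂).cluster u = A :=
      Current.cluster_eq_of_agree hC fun e he => by
        simp only [Pi.add_apply, Current.spliceOff_apply_of_not_edgeOff _ _ he]
    refine ⟨⟨⟨?_, ?_⟩, hCf, ⟨hsupp₁, ?_⟩, ⟨hsupp₂, ?_⟩⟩, ?_⟩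
    · rw [hsrc₁', hp₁, hq₁s, Finset.filter_empty, Finset.union_empty]
    · rw [hsrc₂', hp₂, hq₂s, Finset.filter_empty, Finset.union_empty]
    · rw [hsrc₁, hp₁]
    · rw [hsrc₂, hp₂]
    · have hΦ' : Φ (Current.spliceOff A q₁ p₁ + Current.spliceOff A q₂ p₂) = Φ (p₁ + p₂) := by
        rw [Current.spliceOff_add_spliceOff]
        exact hΦ (p₁ + p₂) (q₁ + q₂) hC (Current.isSupp_add hq₁ hq₂)
      change wA ((p₁, p₂), (q₁, q₂)) = wB (f ((p₁, p₂), (q₁, q₂)))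
      simp only [hwA, hwB, hf, hΦ']
      calc p₁.eweight K * p₂.eweight K * Φ (p₁ + p₂) * (q₁.eweight K * q₂.eweight K)
          = (p₁.eweight K * q₁.eweight K) * (p₂.eweight K * q₂.eweight K) * Φ (p₁ + p₂) := by ring
        _ = ((Current.spliceOff A p₁ q₁).eweight K * (Current.spliceOff A q₁ p₁).eweight K) *
              ((Current.spliceOff A p₂ q₂).eweight K * (Current.spliceOff A q₂ p₂).eweight K) *
                Φ (p₁ + p₂) := by
            rw [Current.eweight_spliceOff_mul_eweight_spliceOff hK A p₁ q₁,
              Current.eweight_spliceOff_mul_eweight_spliceOff hK A p₂ q₂]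
        _ = _ := by ring
  have hback : ∀ x, PB (f x) → PA x := by
    rintro ⟨⟨p₁, p₂⟩, ⟨q₁, q₂⟩⟩ ⟨⟨hp₁, hp₂⟩, hC, ⟨hq₁, hq₁s⟩, ⟨hq₂, hq₂s⟩⟩
    simp only [hf] at hp₁ hp₂ hC hq₁ hq₁s hq₂ hq₂s
    have hC' : (Current.spliceOff A p₂ q₂ + Current.spliceOff A p₁ q₁).cluster u = A := by
      rwa [add_comm]
    obtain ⟨-, hsupp₁, hsrc₁, hsrc₁'⟩ := Current.splice_transfer hC' hq₁
    obtain ⟨-, hsupp₂, hsrc₂, hsrc₂'⟩ := Current.splice_transfer hC hq₂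
    rw [Current.spliceOff_spliceOff] at hsupp₁ hsrc₁ hsrc₁' hsupp₂ hsrc₂ hsrc₂'
    have hCb : (p₁ + p₂).cluster u = A := by
      refine Current.cluster_eq_of_agree hC fun e he => ?_
      simp only [Pi.add_apply, Current.spliceOff]
      by_cases ho : Current.EdgeOff A (e : Sym2 V)
      · exact absurd ho he
      · simp [ho]
    refine ⟨⟨?_, ?_⟩, hCb, ⟨hsupp₁, ?_⟩, ⟨hsupp₂, ?_⟩⟩
    · rw [hsrc₁', hp₁, hq₁s, hself, hself', Finset.filter_union_filter_not_eq]
    · rw [hsrc₂', hp₂, hq₂s, hself, hself', Finset.filter_union_filter_not_eq]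
    · rw [hsrc₁, hp₁, hnone]
    · rw [hsrc₂, hp₂, hnone]
  classical
  exact tsum_ite_eq_of_involutive f hinv PA PB wA wB (fun x hx => (htrans x hx).1)
    (fun q hq => hback (f q) (by rw [hinv q]; exact hq)) (fun x hx => (htrans x hx).2)

/-- Cutting the couplings off at `A` inside a pair weight is inserting the indicator that the sum of the two
currents is supported off `A`. [folklore] -/
theorem epairWeight_mul_ite_isSupp (K : G.edgeFinset → ℝ) (A S T : Finset V) (p : Current G × Current G) :
    epairWeight K S T p * (if Current.IsSupp (offGraph G A) (p.1 + p.2) then 1 else 0) =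
      epairWeight (cutCoupling K A) S T p := by
  rw [Current.epairWeight_cutCoupling, epairWeight]
  have hiff : Current.IsSupp (offGraph G A) (p.1 + p.2) ↔
      Current.IsSupp (offGraph G A) p.1 ∧ Current.IsSupp (offGraph G A) p.2 :=
    ⟨fun h => ⟨Current.isSupp_of_isSupp_add_left h, Current.isSupp_of_isSupp_add_right h⟩,
      fun h => Current.isSupp_add h.1 h.2⟩
  by_cases h1 : Current.IsSupp (offGraph G A) p.1 <;> by_cases h2 : Current.IsSupp (offGraph G A) p.2 <;>
    by_cases h3 : p.1.sources = S <;> by_cases h4 : p.2.sources = T <;> simp [hiff, h1, h2, h3, h4]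

/-- **Step (1), splicing at the thin cluster `A`**: for `S ⊆ A`, `T ⊆ A'`, `A ∩ A' = ∅`,
`M(A,A') · Z_A[∅]² = J_A(a; S,∅) · J'_{A'}(c; ∅,T)`, `J'` the frozen-cluster mass for the couplings cut off
at `A` (the spectator weight `1{C(c) = A'}` does not see the part of the current meeting `A`, as `c ∉ A` or
the weight vanishes identically). [cite: AizenmanCMP1982, §5 (conditioning on clusters)] -/
theorem thin_step {K : G.edgeFinset → ℝ} (hK : ∀ e, 0 ≤ K e) (a c : V) (S T : Finset V) {A A' : Finset V}
    (hSA : S ⊆ A) (hTA : T ⊆ A') (hAA : Disjoint A A') :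
    (∑' p : Current G × Current G, epairWeight K S T p * (if (p.1 + p.2).cluster a = A then 1 else 0) *
          (if (p.1 + p.2).cluster c = A' then 1 else 0)) *
        (ecurrentSum (cutCoupling K A) ∅ * ecurrentSum (cutCoupling K A) ∅) =
      Current.jmass K a A S ∅ * Current.jmass (cutCoupling K A) c A' ∅ T := by
  have hΦ : ∀ m k : Current G, m.cluster a = A → Current.IsSupp (offGraph G A) k →
      (fun n : Current G => if n.cluster c = A' then (1 : ℝ≥0∞) else 0) (Current.spliceOff A k m) =
        (fun n : Current G => if n.cluster c = A' then (1 : ℝ≥0∞) else 0) m := by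
    intro m k hm hk
    by_cases hc : c ∈ A
    · have hc' : c ∉ A' := Finset.disjoint_left.1 hAA hc
      have h0 : ∀ n : Current G, ¬ n.cluster c = A' := fun n h => hc' (h ▸ Current.mem_cluster_self n c)
      simp only [if_neg (h0 _)]
    · simp only [Current.cluster_spliceOff_eq_of_notMem hm hc hk]
  have key := splice_phi hK a A S T (fun n : Current G => if n.cluster c = A' then (1 : ℝ≥0∞) else 0) hΦ
  have hS₁ : S.filter (· ∈ A) = S := Finset.filter_true_of_mem fun x hx => hSA hx
  have hS₂ : S.filter (· ∉ A) = ∅ := Finset.filter_false_of_mem fun x hx h => h (hSA hx)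
  have hT₁ : T.filter (· ∈ A) = ∅ :=
    Finset.filter_false_of_mem fun x hx h => Finset.disjoint_left.1 hAA h (hTA hx)
  have hT₂ : T.filter (· ∉ A) = T :=
    Finset.filter_true_of_mem fun x hx h => Finset.disjoint_left.1 hAA h (hTA hx)
  rw [hS₁, hS₂, hT₁, hT₂, tsum_epairWeight] at key
  exact key

/-- **Step (2), transferring the fat cluster `A'` to the cut-off couplings**: for `T ⊆ A'`, `A ∩ A' = ∅`,
`J'_{A'}(c; ∅,T) · Z_{A'}[∅]² = J_{A'}(c; ∅,T) · Z_{A∪A'}[∅]²` (splice at `A'` with the spectator weight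
`1{supported off A}`: an edge meeting both `A` and `A' = C(c)` carries no current). [cite: AizenmanCMP1982, §5 (conditioning on clusters)] -/
theorem fat_step {K : G.edgeFinset → ℝ} (hK : ∀ e, 0 ≤ K e) (c : V) (T : Finset V) {A A' : Finset V}
    (hTA : T ⊆ A') (hAA : Disjoint A A') :
    Current.jmass (cutCoupling K A) c A' ∅ T * (ecurrentSum (cutCoupling K A') ∅ * ecurrentSum (cutCoupling K A') ∅) =
      Current.jmass K c A' ∅ T *
        (ecurrentSum (cutCoupling K (A ∪ A')) ∅ * ecurrentSum (cutCoupling K (A ∪ A')) ∅) := by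
  have hΦ : ∀ m k : Current G, m.cluster c = A' → Current.IsSupp (offGraph G A') k →
      (fun n : Current G => if Current.IsSupp (offGraph G A) n then (1 : ℝ≥0∞) else 0)
          (Current.spliceOff A' k m) =
        (fun n : Current G => if Current.IsSupp (offGraph G A) n then (1 : ℝ≥0∞) else 0) m := by
    intro m k hm hk
    have hiff : Current.IsSupp (offGraph G A) (Current.spliceOff A' k m) ↔ Current.IsSupp (offGraph G A) m := by
      rw [isSupp_offGraph_iff, isSupp_offGraph_iff]
      refine forall_congr' fun e => imp_congr_right fun he => ?_
      by_cases ho : Current.EdgeOff A' (e : Sym2 V)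
      · rw [Current.spliceOff_apply_of_edgeOff _ _ ho]
      · rw [Current.spliceOff_apply_of_not_edgeOff _ _ ho, (isSupp_offGraph_iff.1 hk) e ho]
        -- `e` meets `A` and `A' = C_m(c)`: it carries no current
        have hme : m e = 0 := by
          simp only [Current.EdgeOff, not_forall, not_not, exists_prop] at he ho
          obtain ⟨x, hxe, hxA⟩ := he
          obtain ⟨y, hye, hyA⟩ := ho
          have hxA' : x ∉ A' := Finset.disjoint_left.1 hAA hxA
          have hne : y ≠ x := fun h => hxA' (h ▸ hyA)
          exact Current.apply_eq_zero_of_cluster_eq hm ((Sym2.mem_and_mem_iff hne).1 ⟨hye, hxe⟩) hyA hxA'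
        rw [hme]
    by_cases hs : Current.IsSupp (offGraph G A) m
    · simp only [if_pos hs, if_pos (hiff.2 hs)]
    · simp only [if_neg hs, if_neg (fun h => hs (hiff.1 h))]
  have key := splice_phi hK c A' ∅ T
    (fun n : Current G => if Current.IsSupp (offGraph G A) n then (1 : ℝ≥0∞) else 0) hΦ
  have hT₁ : T.filter (· ∈ A') = T := Finset.filter_true_of_mem fun x hx => hTA hx
  have hT₂ : T.filter (· ∉ A') = ∅ := Finset.filter_false_of_mem fun x hx h => h (hTA hx)
  rw [Finset.filter_empty, Finset.filter_empty, hT₁, hT₂, tsum_epairWeight] at key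
  have hl : (∑' p : Current G × Current G, epairWeight K ∅ T p *
        (if (p.1 + p.2).cluster c = A' then 1 else 0) *
          (if Current.IsSupp (offGraph G A) (p.1 + p.2) then 1 else 0)) =
      Current.jmass (cutCoupling K A) c A' ∅ T := by
    unfold Current.jmass
    refine tsum_congr fun p => ?_
    rw [mul_right_comm, epairWeight_mul_ite_isSupp]
  have hr : (∑' q : Current G × Current G, epairWeight (cutCoupling K A') ∅ ∅ q *
        (if Current.IsSupp (offGraph G A) (q.1 + q.2) then 1 else 0)) =
      ecurrentSum (cutCoupling K (A ∪ A')) ∅ * ecurrentSum (cutCoupling K (A ∪ A')) ∅ := by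
    rw [← tsum_epairWeight, Finset.union_comm, ← cutCoupling_cutCoupling]
    exact tsum_congr fun q => epairWeight_mul_ite_isSupp _ A ∅ ∅ q
  rw [hl, hr] at key
  rw [key]
  rfl

end Splice

/-- **Side stub `stub_thinFatLaw`** (the exact THIN/FAT two-cluster law on a finite graph: for disjoint
`A ∋ a`, `A' ∋ c`, `P^{S,T}[C(a)=A, C(c)=A'] Z_A[∅]² Z_{A'}[∅]² = jmass(a,A,S) jmass(c,A',T) Z_{A∪A'}[∅]²`).
Proof: `thin_step` (splice at `A`, spectator `1{C(c)=A'}`) then `fat_step` (splice at `A'`, spectator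
`1{supported off A}`). [cite: Aizenman1982, Lemma 9.3] -/
theorem stub_thinFatLaw :
    ∀ {V : Type} [Fintype V] [DecidableEq V] {G : SimpleGraph V} [DecidableRel G.Adj] (K : G.edgeFinset → ℝ),
      (∀ e, 0 ≤ K e) → ∀ (a c : V) (S T A A' : Finset V), S ⊆ A → T ⊆ A' → Disjoint A A' →
      (∑' p : Current G × Current G, epairWeight K S T p * (if (p.1 + p.2).cluster a = A then 1 else 0) *
          (if (p.1 + p.2).cluster c = A' then 1 else 0)) *
        (ecurrentSum (cutCoupling K A) ∅ * ecurrentSum (cutCoupling K A) ∅) *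
        (ecurrentSum (cutCoupling K A') ∅ * ecurrentSum (cutCoupling K A') ∅) =
      Current.jmass K a A S ∅ * Current.jmass K c A' ∅ T *
        (ecurrentSum (cutCoupling K (A ∪ A')) ∅ * ecurrentSum (cutCoupling K (A ∪ A')) ∅) := by
  intro V _ _ G _ K hK a c S T A A' hSA hTA hAA
  rw [thin_step hK a c S T hSA hTA hAA, mul_assoc, fat_step hK c T hTA hAA, ← mul_assoc]

end Summit.CriticalPhenomena.Ising3DConformalLimit.Cruxes.CoulombImpliesNontrivial.MergingIsExpectedScreening

end
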